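import Literature.NumberTheory.GelbartRogawski1991.UnitaryDualPairThetaKernelCM
import Literature.NumberTheory.Automorphic.UnitaryGroupArchIsotropy
import HarnessLib

/-!
# The theta-kernel datum of a CM unitary dual pair with its archimedean `K`-type PINNED

Topic `NumberTheory/GelbartRogawski1991`; namespace
`Literature.NumberTheory.GelbartRogawski1991.UnitaryDualPair` (continues `UnitaryDualPairThetaKernelCM`).

KERNEL JUNCTION (no new named fact).  `cmThetaKernelDatum hGR hρ SK hSK` — Weil's theta-kernel datum of the
CM dual pair `(U(diag dV), U(diag dW))` over `L / L⁺` — takes the `K`-type set `SK ⊆ 𝒮(𝔸_{L⁺}^n)` and its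
stability under `1 × U(diag dW)(𝔸)` as DATA.  Here the set is PINNED to the object the period argument uses:
the `χ`-isotypic subspace of the pair representation `cmPairRep hGR` for `K_∞ × 1`, where
`K_∞ = archIsotropy L H τ T hT ≤ U(H)(L ⊗ ℝ)` is the archimedean isotropy group of the ORIGINAL hermitian
matrix `H ∈ M₃(L)` at the distinguished place `τ` [UnitaryGroupArchIsotropy], acting on `𝒮(𝔸_{L⁺}^n)` through
the frame transport `x ↦ g_𝔸⁻¹ x g_𝔸 : U(H)(𝔸_{L⁺}) → U(diag dV)(𝔸_{L⁺})` of a diagonal frame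
`ᵗḡ H g = diag dV` (`cmFrameEquiv` of [UnitaryDualPairThetaKernelCM]).  This file supplies:

* `cmKTypeHom L H g d hg : U(H)(𝔸_{L⁺}) →* U(diag d)(𝔸_{L⁺})` — the currency conversion
  `cmFrameEquiv ∘ cmAdelicEquiv⁻¹` between the generic carriers `Automorphic.UnitaryGroup.adelic` (any rank `N`),
  with `coe_cmKTypeHom` (`= g_𝔸⁻¹ x g_𝔸` in `GL_N(𝔸_L)`), `continuous_cmKTypeHom`, `cmKTypeHom_cmAdelicEquiv`,
  and `cmKTypeHom_mem_range_toAdelic` (rational points go to rational points);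
* `cmKType L e dV … dW … hGR H g hg τ T hT χ : Submodule ℂ (𝒮(𝔸_{L⁺}^n))` — the `χ`-ISOTYPIC SUBSPACE
  `{Φ | ∀ k ∈ K_∞, ω(s_pair(g_𝔸⁻¹ (k, 1_f) g_𝔸, 1)) Φ = χ(k) Φ}` (`Automorphic.UnitaryGroup.kappaIsotypic` of the
  pair representation through `cmKTypeHom`; `χ = archKappa …` is the `∧²𝔭₊ ⊠ 𝟏` character, `archKappaInv …` the
  dual convention — the file is stated for any `χ : K_∞ →* ℂˣ`), with `mem_cmKType_iff`, the stability
  `cmKType_stable` under `1 × U(diag dW)(𝔸)` (= `kappaIsotypic_stable_inr'`), and `zero_mem_cmKType`,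
  `add_mem_cmKType`, `smul_mem_cmKType` in the `Set`-level shape a `ThetaKernelDatum` consumer quotes;
* `cmThetaKernelDatumK … hGR hρ H g hg τ T hT χ := cmThetaKernelDatum … hGR hρ (cmKType …) (cmKType_stable …)`
  — WEIL'S THETA-KERNEL DATUM OF THE CM PAIR WITH ITS `K`-TYPE PINNED — and its `rfl` API (`_s`,
  `_act`, `_SK`, `_thetaFun_mk`, continuity, right-invariance under `U(diag dV)(L⁺) × U(diag dW)(L⁺)`).

After this file the datum's only non-constructive inputs are the two analytic statements it is typed over —
`hGR : (cmSplittingDatum …).CompatibleSplitting` ([GelbartRogawski1991, Prop. 3.1.1] at this pair) and the theta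
majorants `hρ` of the pair representation ([Weil1964, Chap. III n° 41]) — plus the choice of a diagonal frame
`(g, dV)` of `H` and of the archimedean frame `(τ, T)`.

References: A. Weil, Acta Math. 111 (1964), Chap. III n° 37, 41 [Weil1964]; S. Gelbart, J. Rogawski, Invent.
Math. 105 (1991) §3.1 [GelbartRogawski1991]; A. Borel, H. Jacquet, Proc. Sympos. Pure Math. 33.1 (1979) §4.1
(archimedean components, maximal compact subgroups) [BorelJacquet1979].
-/

noncomputable section

open scoped Matrix
open NumberField
open Literature.NumberTheory.Automorphic
open Literature.NumberTheory.Weil1964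
open Literature.Geometry.ComplexHyperbolic

namespace Literature.NumberTheory.GelbartRogawski1991

namespace UnitaryDualPair

/-! ## The currency conversion `U(H)(𝔸_{L⁺}) →* U(diag d)(𝔸_{L⁺})` through a diagonal frame -/

section KTypeHom

variable (L : Type) [Field L] [NumberField L] [IsCMField L] {N : ℕ} (H : Matrix (Fin N) (Fin N) L)
  (g : GL (Fin N) L) (d : Fin N → L)
  (hg : ((g : Matrix (Fin N) (Fin N) L).map (cmConjRingHom L))ᵀ * H * (g : Matrix (Fin N) (Fin N) L) =
    Matrix.diagonal d)

/-- **`x ↦ g_𝔸⁻¹ x g_𝔸 : U(H)(𝔸_{L⁺}) →* U(diag d)(𝔸_{L⁺})`** for a frame `ᵗḡ H g = diag d`, in the generic-carrier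
currency `Automorphic.UnitaryGroup.adelic` on both sides: `cmFrameEquiv L g H d hg ∘ (cmAdelicEquiv L N H)⁻¹`.
[folklore] -/
noncomputable def cmKTypeHom :
    ↥(UnitaryGroup.adelic (↥(maximalRealSubfield L)) L (IsCMField.complexConj L) N H) →*
      ↥(UnitaryGroup.adelic (↥(maximalRealSubfield L)) L (IsCMField.complexConj L) N (Matrix.diagonal d)) :=
  (cmFrameEquiv L g H d hg).toMonoidHom.comp (cmAdelicEquiv L N H).symm.toMonoidHom

/-- `cmKTypeHom x = cmFrameEquiv (cmAdelicEquiv⁻¹ x)`. [folklore] -/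
theorem cmKTypeHom_apply (x : ↥(UnitaryGroup.adelic (↥(maximalRealSubfield L)) L (IsCMField.complexConj L) N H)) :
    cmKTypeHom L H g d hg x = cmFrameEquiv L g H d hg ((cmAdelicEquiv L N H).symm x) := rfl

/-- `cmKTypeHom (cmAdelicEquiv x) = cmFrameEquiv x`: on the CM carrier `adelicUnitaryGroup L H` the conversion IS the
frame transport. [folklore] -/
@[simp] theorem cmKTypeHom_cmAdelicEquiv (x : ↥(adelicUnitaryGroup L H)) :
    cmKTypeHom L H g d hg (cmAdelicEquiv L N H x) = cmFrameEquiv L g H d hg x := by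
  rw [cmKTypeHom_apply, ContinuousMulEquiv.symm_apply_apply]

/-- `cmKTypeHom x = g_𝔸⁻¹ x g_𝔸` in `GL_N(𝔸_L)`. [folklore] -/
@[simp] theorem coe_cmKTypeHom (x : ↥(UnitaryGroup.adelic (↥(maximalRealSubfield L)) L (IsCMField.complexConj L) N H)) :
    ((cmKTypeHom L H g d hg x :
        ↥(UnitaryGroup.adelic (↥(maximalRealSubfield L)) L (IsCMField.complexConj L) N (Matrix.diagonal d))) :
          GL (Fin N) (AdeleRing (𝓞 L) L)) =
      (toAdeleGL L g)⁻¹ * x * toAdeleGL L g :=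
  coe_cmFrameEquiv L g H d hg _

/-- `cmKTypeHom` is continuous. [folklore] -/
theorem continuous_cmKTypeHom : Continuous (cmKTypeHom L H g d hg) :=
  (continuous_cmFrameEquiv L g H d hg).comp (cmAdelicEquiv L N H).symm.continuous

/-- **`cmKTypeHom` respects rational points**: `γ ∈ U(H)(L⁺) ⇒ g_𝔸⁻¹ γ g_𝔸 ∈ U(diag d)(L⁺)`. [folklore] -/
theorem cmKTypeHom_mem_range_toAdelic
    {γ : ↥(UnitaryGroup.adelic (↥(maximalRealSubfield L)) L (IsCMField.complexConj L) N H)}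
    (hγ : γ ∈ (UnitaryGroup.toAdelic (↥(maximalRealSubfield L)) L (IsCMField.complexConj L) N H).range) :
    cmKTypeHom L H g d hg γ ∈
      (UnitaryGroup.toAdelic (↥(maximalRealSubfield L)) L (IsCMField.complexConj L) N (Matrix.diagonal d)).range :=
  cmFrameEquiv_mem_range_toAdelic L g H d hg
    ((cmAdelicEquiv_mem_range_toAdelic_iff L N H ((cmAdelicEquiv L N H).symm γ)).1
      (by rwa [ContinuousMulEquiv.apply_symm_apply]))

end KTypeHom

/-! ## The `χ`-isotypic `K`-type of the CM pair representation and the pinned theta-kernel datum -/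

section KType

variable (L : Type) [Field L] [NumberField L] [IsCMField L] {M n : ℕ} (e : Fin 3 × Fin M ≃ Fin n)
variable (dV : Fin 3 → L) (hdV : ∀ i, IsCMField.complexConj L (dV i) = dV i) (hdV0 : ∀ i, dV i ≠ 0)
variable (dW : Fin M → L) (hdW : ∀ i, IsCMField.complexConj L (dW i) = dW i) (hdW0 : ∀ i, dW i ≠ 0)
variable (hGR : (cmSplittingDatum L e dV hdV hdV0 dW hdW hdW0).CompatibleSplitting)
  (hρ : HasThetaMajorants fun
    (p : ↥(UnitaryGroup.adelic (↥(maximalRealSubfield L)) L (IsCMField.complexConj L) 3 (Matrix.diagonal dV)) ×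
      ↥(UnitaryGroup.adelic (↥(maximalRealSubfield L)) L (IsCMField.complexConj L) M (Matrix.diagonal dW)))
    (Φ : piSchwartzBruhat (↥(maximalRealSubfield L)) (Fin n)) =>
      adelicMpCont.omega (↥(maximalRealSubfield L)) (Fin n)
        (adelicGram (↥(maximalRealSubfield L)) e (realDiagonal L dV hdV) (realDiagonal L dW hdW))
        (cmPairSplitting L e dV hdV hdV0 dW hdW hdW0 hGR p) Φ)
variable (H : Matrix (Fin 3) (Fin 3) L) (g : GL (Fin 3) L)
  (hg : ((g : Matrix (Fin 3) (Fin 3) L).map (cmConjRingHom L))ᵀ * H * (g : Matrix (Fin 3) (Fin 3) L) =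
    Matrix.diagonal dV)
  (τ : L →+* ℂ) (T : GL (Fin 3) ℂ) (hT : formCongr (starRingEnd ℂ) T (H.map τ) = BallModel.J)
  (χ : ↥(UnitaryGroup.archIsotropy L H τ T hT) →* ℂˣ)

/-- **the `χ`-isotypic `K`-type `𝒮^χ ⊆ 𝒮(𝔸_{L⁺}^n)` of the CM pair representation** for `K_∞ × 1`,
`K_∞ = archIsotropy L H τ T hT` acting through the frame transport `cmKTypeHom`:
`{Φ | ∀ k ∈ K_∞, cmPairRep hGR (g_𝔸⁻¹ (k, 1_f) g_𝔸, 1) Φ = χ(k) • Φ}` (`UnitaryGroup.kappaIsotypic`). [folklore] -/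
noncomputable def cmKType : Submodule ℂ (piSchwartzBruhat (↥(maximalRealSubfield L)) (Fin n)) :=
  UnitaryGroup.kappaIsotypic (cmPairRep L e dV hdV hdV0 dW hdW hdW0 hGR) (cmKTypeHom L H g dV hg) χ

/-- `cmKType` IS `kappaIsotypic` of the pair representation through `cmKTypeHom` (definitional). [folklore] -/
theorem cmKType_eq :
    cmKType L e dV hdV hdV0 dW hdW hdW0 hGR H g hg τ T hT χ =
      UnitaryGroup.kappaIsotypic (cmPairRep L e dV hdV hdV0 dW hdW hdW0 hGR) (cmKTypeHom L H g dV hg) χ := rfl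

/-- Membership in the `χ`-isotypic `K`-type. [folklore] -/
theorem mem_cmKType_iff (Φ : piSchwartzBruhat (↥(maximalRealSubfield L)) (Fin n)) :
    Φ ∈ cmKType L e dV hdV hdV0 dW hdW hdW0 hGR H g hg τ T hT χ ↔
      ∀ k : ↥(UnitaryGroup.archIsotropy L H τ T hT),
        cmPairRep L e dV hdV hdV0 dW hdW hdW0 hGR
            (cmKTypeHom L H g dV hg (UnitaryGroup.archIsotropyToAdelic L H τ T hT k), 1) Φ = (χ k : ℂ) • Φ :=
  UnitaryGroup.mem_kappaIsotypic_iff _ _ _ _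

/-- **stability of the `K`-type under `1 × U(diag dW)(𝔸)`** — the `hSK` clause of `cmThetaKernelDatum`, in its
literal `Set`-level shape. [folklore] -/
theorem cmKType_stable :
    ∀ (h : ↥(UnitaryGroup.adelic (↥(maximalRealSubfield L)) L (IsCMField.complexConj L) M (Matrix.diagonal dW)))
      (Φ : piSchwartzBruhat (↥(maximalRealSubfield L)) (Fin n)),
      Φ ∈ (cmKType L e dV hdV hdV0 dW hdW hdW0 hGR H g hg τ T hT χ :
          Set (piSchwartzBruhat (↥(maximalRealSubfield L)) (Fin n))) →
        cmPairRep L e dV hdV hdV0 dW hdW hdW0 hGR (1, h) Φ ∈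
          (cmKType L e dV hdV hdV0 dW hdW hdW0 hGR H g hg τ T hT χ :
              Set (piSchwartzBruhat (↥(maximalRealSubfield L)) (Fin n))) :=
  UnitaryGroup.kappaIsotypic_stable_inr' _ _ _

/-- `0 ∈ 𝒮^χ` (`Set`-level). [folklore] -/
theorem zero_mem_cmKType :
    (0 : piSchwartzBruhat (↥(maximalRealSubfield L)) (Fin n)) ∈
      (cmKType L e dV hdV hdV0 dW hdW hdW0 hGR H g hg τ T hT χ :
          Set (piSchwartzBruhat (↥(maximalRealSubfield L)) (Fin n))) :=
  Submodule.zero_mem _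

/-- `𝒮^χ` is closed under addition (`Set`-level). [folklore] -/
theorem add_mem_cmKType {Φ Ψ : piSchwartzBruhat (↥(maximalRealSubfield L)) (Fin n)}
    (hΦ : Φ ∈ (cmKType L e dV hdV hdV0 dW hdW hdW0 hGR H g hg τ T hT χ :
        Set (piSchwartzBruhat (↥(maximalRealSubfield L)) (Fin n))))
    (hΨ : Ψ ∈ (cmKType L e dV hdV hdV0 dW hdW hdW0 hGR H g hg τ T hT χ :
        Set (piSchwartzBruhat (↥(maximalRealSubfield L)) (Fin n)))) :
    Φ + Ψ ∈ (cmKType L e dV hdV hdV0 dW hdW hdW0 hGR H g hg τ T hT χ :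
        Set (piSchwartzBruhat (↥(maximalRealSubfield L)) (Fin n))) :=
  Submodule.add_mem _ hΦ hΨ

/-- `𝒮^χ` is closed under scalars (`Set`-level). [folklore] -/
theorem smul_mem_cmKType (a : ℂ) {Φ : piSchwartzBruhat (↥(maximalRealSubfield L)) (Fin n)}
    (hΦ : Φ ∈ (cmKType L e dV hdV hdV0 dW hdW hdW0 hGR H g hg τ T hT χ :
        Set (piSchwartzBruhat (↥(maximalRealSubfield L)) (Fin n)))) :
    a • Φ ∈ (cmKType L e dV hdV hdV0 dW hdW hdW0 hGR H g hg τ T hT χ :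
        Set (piSchwartzBruhat (↥(maximalRealSubfield L)) (Fin n))) :=
  Submodule.smul_mem _ a hΦ

/-- **WEIL'S THETA-KERNEL DATUM OF THE CM DUAL PAIR `U(diag dV) × U(diag dW)` WITH ITS `K`-TYPE PINNED** to the
`χ`-isotypic subspace of `K_∞ = archIsotropy L H τ T hT` through the frame `g`:
`cmThetaKernelDatum hGR hρ (cmKType …) (cmKType_stable …)`. [cite: Weil1964, Chap. III n° 41 Thm 6 p. 193] -/
noncomputable def cmThetaKernelDatumK :=
  cmThetaKernelDatum L e dV hdV hdV0 dW hdW hdW0 hGR hρ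
    (cmKType L e dV hdV hdV0 dW hdW hdW0 hGR H g hg τ T hT χ :
        Set (piSchwartzBruhat (↥(maximalRealSubfield L)) (Fin n)))
    (cmKType_stable L e dV hdV hdV0 dW hdW hdW0 hGR H g hg τ T hT χ)

/-- the lift of the pinned CM datum is the identity. [folklore] -/
theorem cmThetaKernelDatumK_s :
    (cmThetaKernelDatumK L e dV hdV hdV0 dW hdW hdW0 hGR hρ H g hg τ T hT χ).s = MonoidHom.id _ := rfl

/-- the Weil action of the pinned CM datum: `W.act p Φ = ω_ψ(s_pair p) Φ`. [cite: Weil1964, Chap. III n° 41 p. 193] -/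
theorem cmThetaKernelDatumK_act
    (p : ↥(UnitaryGroup.adelic (↥(maximalRealSubfield L)) L (IsCMField.complexConj L) 3 (Matrix.diagonal dV)) ×
      ↥(UnitaryGroup.adelic (↥(maximalRealSubfield L)) L (IsCMField.complexConj L) M (Matrix.diagonal dW)))
    (Φ : piSchwartzBruhat (↥(maximalRealSubfield L)) (Fin n)) :
    (cmThetaKernelDatumK L e dV hdV hdV0 dW hdW hdW0 hGR hρ H g hg τ T hT χ).W.act p Φ =
      cmPairRep L e dV hdV hdV0 dW hdW hdW0 hGR p Φ := rfl

/-- **the `K`-type set of the pinned CM datum is the `χ`-isotypic subspace `𝒮^χ`.** [folklore] -/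
theorem cmThetaKernelDatumK_SK :
    (cmThetaKernelDatumK L e dV hdV hdV0 dW hdW hdW0 hGR hρ H g hg τ T hT χ).SK =
      (cmKType L e dV hdV hdV0 dW hdW hdW0 hGR H g hg τ T hT χ :
          Set (piSchwartzBruhat (↥(maximalRealSubfield L)) (Fin n))) := rfl

/-- the theta kernel of the pinned CM datum: `θ_Φ(x, h) = Θ(ω_ψ(s_pair(x⁻¹, h⁻¹)) Φ)`.
[cite: Weil1964, Chap. III n° 41 Thm 6 p. 193] -/
theorem cmThetaKernelDatumK_thetaFun_mk (Φ : piSchwartzBruhat (↥(maximalRealSubfield L)) (Fin n))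
    (x : ↥(UnitaryGroup.adelic (↥(maximalRealSubfield L)) L (IsCMField.complexConj L) 3 (Matrix.diagonal dV)))
    (h : ↥(UnitaryGroup.adelic (↥(maximalRealSubfield L)) L (IsCMField.complexConj L) M (Matrix.diagonal dW))) :
    (cmThetaKernelDatumK L e dV hdV hdV0 dW hdW hdW0 hGR hρ H g hg τ T hT χ).thetaFun Φ (x, h) =
      thetaDistLM (↥(maximalRealSubfield L)) (Fin n) (cmPairRep L e dV hdV hdV0 dW hdW hdW0 hGR (x⁻¹, h⁻¹) Φ) :=
  rfl

/-- the theta kernel of the pinned CM datum is continuous. [folklore] -/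
theorem continuous_cmThetaKernelDatumK_thetaFun (Φ : piSchwartzBruhat (↥(maximalRealSubfield L)) (Fin n)) :
    Continuous ((cmThetaKernelDatumK L e dV hdV hdV0 dW hdW hdW0 hGR hρ H g hg τ T hT χ).thetaFun Φ) :=
  (cmThetaKernelDatumK L e dV hdV hdV0 dW hdW hdW0 hGR hρ H g hg τ T hT χ).continuous_thetaFun Φ

/-- the theta kernel of the pinned CM datum is right-invariant under `U(diag dV)(L⁺) × U(diag dW)(L⁺)`.
[cite: Weil1964, Chap. III n° 41 Thm 6 p. 193] -/
theorem cmThetaKernelDatumK_thetaFun_mul_right (Φ : piSchwartzBruhat (↥(maximalRealSubfield L)) (Fin n))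
    (p : ↥(UnitaryGroup.adelic (↥(maximalRealSubfield L)) L (IsCMField.complexConj L) 3 (Matrix.diagonal dV)) ×
      ↥(UnitaryGroup.adelic (↥(maximalRealSubfield L)) L (IsCMField.complexConj L) M (Matrix.diagonal dW)))
    {γU : ↥(UnitaryGroup.adelic (↥(maximalRealSubfield L)) L (IsCMField.complexConj L) 3 (Matrix.diagonal dV))}
    (hγU : γU ∈
      (UnitaryGroup.toAdelic (↥(maximalRealSubfield L)) L (IsCMField.complexConj L) 3 (Matrix.diagonal dV)).range)
    {γ : ↥(UnitaryGroup.adelic (↥(maximalRealSubfield L)) L (IsCMField.complexConj L) M (Matrix.diagonal dW))}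
    (hγ : γ ∈
      (UnitaryGroup.toAdelic (↥(maximalRealSubfield L)) L (IsCMField.complexConj L) M (Matrix.diagonal dW)).range) :
    (cmThetaKernelDatumK L e dV hdV hdV0 dW hdW hdW0 hGR hρ H g hg τ T hT χ).thetaFun Φ (p * (γU, γ)) =
      (cmThetaKernelDatumK L e dV hdV hdV0 dW hdW hdW0 hGR hρ H g hg τ T hT χ).thetaFun Φ p :=
  (cmThetaKernelDatumK L e dV hdV hdV0 dW hdW hdW0 hGR hρ H g hg τ T hT χ).thetaFun_mul_right Φ p hγU hγ

end KType

end UnitaryDualPair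

end Literature.NumberTheory.GelbartRogawski1991

end

/-! ### Build-lane note (ops-buildfix G11b-3 recipe v2, LEDGER B13-1/B14-5/B14-7, 2026-08-22)
`lean -o` (the hub build lane, never `lean`/the gate check) runs Lean 4.32's library-suggestion indexers
(`Lean.LibrarySuggestions.SymbolFrequency` / `SineQuaNon`, from their `exportEntriesFn`) over the statement of every local
theorem constant that is not a denied premise; on this family's statements (very large dependent binder telescopes) that fold
runs for tens of minutes (incident G11b-3, run/shared/lean/ops/buildfix/G11b-3-DOSSIER.md). `isDeniedPremise` skips
`[implicit_reducible]` constants before any fold, and the status is inert on theorems (Meta never unfolds `thmInfo`).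
v2 form: ONE file-final, top-level `local` attribute — it goes through the synchronous scoped reducibility extension that
`getReducibilityStatusCore` reads first, so it needs no `set_option Elab.async false` (parallel elaboration stays on), also
reaches auto-realized `*.congr_simp` / structure-projection theorem constants, is never popped before export, and is not
exported. No statement or proof is changed. -/
set_option allowUnsafeReducibility true in
attribute [local implicit_reducible]
  Literature.NumberTheory.GelbartRogawski1991.UnitaryDualPair.cmKTypeHom_apply
  Literature.NumberTheory.GelbartRogawski1991.UnitaryDualPair.cmKTypeHom_cmAdelicEquiv
  Literature.NumberTheory.GelbartRogawski1991.UnitaryDualPair.coe_cmKTypeHom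
  Literature.NumberTheory.GelbartRogawski1991.UnitaryDualPair.continuous_cmKTypeHom
  Literature.NumberTheory.GelbartRogawski1991.UnitaryDualPair.cmKTypeHom_mem_range_toAdelic
  Literature.NumberTheory.GelbartRogawski1991.UnitaryDualPair.cmKType_eq
  Literature.NumberTheory.GelbartRogawski1991.UnitaryDualPair.mem_cmKType_iff
  Literature.NumberTheory.GelbartRogawski1991.UnitaryDualPair.cmKType_stable
  Literature.NumberTheory.GelbartRogawski1991.UnitaryDualPair.zero_mem_cmKType
  Literature.NumberTheory.GelbartRogawski1991.UnitaryDualPair.add_mem_cmKType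
  Literature.NumberTheory.GelbartRogawski1991.UnitaryDualPair.smul_mem_cmKType
  Literature.NumberTheory.GelbartRogawski1991.UnitaryDualPair.cmThetaKernelDatumK_s
  Literature.NumberTheory.GelbartRogawski1991.UnitaryDualPair.cmThetaKernelDatumK_act
  Literature.NumberTheory.GelbartRogawski1991.UnitaryDualPair.cmThetaKernelDatumK_SK
  Literature.NumberTheory.GelbartRogawski1991.UnitaryDualPair.cmThetaKernelDatumK_thetaFun_mk
  Literature.NumberTheory.GelbartRogawski1991.UnitaryDualPair.continuous_cmThetaKernelDatumK_thetaFun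
  Literature.NumberTheory.GelbartRogawski1991.UnitaryDualPair.cmThetaKernelDatumK_thetaFun_mul_right
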